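import Literature.NumberTheory.EllipticCurves.TateCurve.UniformizationPoints
import HarnessLib

/-!
# Rational `n`-torsion on a Tate curve forces an `n`-th root of the Tate parameter
# (the content of [IUTchI] Example 3.2 (iv) "`q_v` admits a `2l`-th root in `K_v̲`")

Topic `Literature/NumberTheory/EllipticCurves/TateCurve`, namespace
`Literature.NumberTheory.EllipticCurves.TateCurve`; proof-only companion (cell abc-iut, seat
abc-iut-w5-d209; classical, takes no side on anything disputed).

Mochizuki, *Inter-universal Teichmüller theory I*, Example 3.2 (iv) (kurims May-2020 manuscript p. 71): "it
follows from our assumption concerning `2`-torsion [cf. Definition 3.1, (b)], together with the definition of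
`K` [cf. Definition 3.1, (c)], that `q_v` admits a `2l`-th root in `𝒪^▷(T_{X̲̲_v}) (≅ 𝒪^▷_{K_v̲})`". The
classical mechanism behind this sentence is Tate's uniformisation `K^×/q^ℤ ⥲ E_q(K)` (Silverman, *Advanced
Topics*, Thm. V.3.1 (c)(d), PROVED in the tree for `L = K`: `tateUniformizationEquiv`,
`tatePoint_surjective`, `tatePoint_eq_zero_iff`): the `n`-torsion of `K^×/q^ℤ` has at most
`#μ_n(K) · #{s mod n : q^s ∈ (K^×)^n}` elements, so it can only have `n²` elements when `q` itself is an
`n`-th power in `K`. This file proves exactly that, fact-free: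

* `exists_pow_eq_of_torsion` — `0 < ‖q‖ < 1`, `0 < n`: if `E_q(K)` has `n²` distinct points killed by `n`
  (a `Finset S` with `∀ P ∈ S, n • P = 0`, `n ^ 2 ≤ S.card`), then `∃ r : K, r ^ n = q`;
* `exists_pow_mul_eq_of_coprime` — `a ^ m = q`, `b ^ n = q`, `m`, `n` coprime, `q ≠ 0` ⇒ `∃ c, c ^ (m * n) = q`
  (so a square root and an `l`-th root, `l` odd, give a `2l`-th root);
* `exists_pow_eq_of_torsion_of_injective` / `exists_pow_eq_of_torsion_of_variableChange` — the same through any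
  injective homomorphism `A →+ E_q(K)`, in particular for any curve `E` with a `K`-isomorphism `C • E = tateCurve q`
  (transport of torsion along the tree's `VariableChange.pointEquiv`);
* (companion file `TorsionRootNumberField.lean`) the corollary at a finite place `v` of a number field `F` where
  `W/F` has SPLIT multiplicative reduction: `n²` rational `n`-torsion points of `W` over `F_v` force `q_v = r ^ n`
  with `v(j(W)) = (v(r))⁻¹ ^ n`, i.e. `n ∣ ord_v(q_v) = −ord_v(j)`.

What is NOT here (the other half of the [IUTchI] residual, owner abc-iut-L5-t2): that a collection of
initial Θ-data ([IUTchI] Def. 3.1) supplies, at `v̲ ∈ V̲^bad`, split multiplicative reduction over `K_v̲` and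
`(2l)²` rational `2l`-torsion points (`E_F[2] ⊆ E_F(F)` by Def. 3.1 (b), `E_F[l] ⊆ E_F(K)` by `K := F(E_F[l])`).

## References
* [SilvermanATAEC1994] J. H. Silverman, *Advanced Topics in the Arithmetic of Elliptic Curves*, GTM 151,
  Springer 1994, Thm. V.3.1 (c)(d) (PDF p. 395), Thm. V.5.3 (PDF pp. 407–409).
* [Mochizuki2012] S. Mochizuki, *Inter-universal Teichmüller theory I*, Example 3.2 (iv), kurims p. 71
  (consumer only; nothing of it is asserted here).
-/

noncomputable section

open scoped Classical

namespace Literature.NumberTheory.EllipticCurves.TateCurve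

open WeierstrassCurve Polynomial SteinWuthrich2013

universe u

/-! ### Coprime roots combine -/

/-- **An `m`-th root and an `n`-th root of the same nonzero `q`, `m` and `n` coprime, give an `mn`-th root**:
with `m·A + n·B = 1` (Bezout), `c := a ^ B · b ^ A` has `c ^ (m n) = q ^ (n B) · q ^ (m A) = q`. In particular a
square root and an `l`-th root (`l` odd) of the Tate parameter give the `2l`-th root `q̲_v` of [IUTchI]
Ex. 3.2 (iv). [cite: SilvermanATAEC1994, Thm. V.3.1 (c)(d) (PDF p. 395)] -/
theorem exists_pow_mul_eq_of_coprime {F : Type*} [Field F] {q a b : F} {m n : ℕ} (hq : q ≠ 0)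
    (hmn : m.Coprime n) (ha : a ^ m = q) (hb : b ^ n = q) : ∃ c : F, c ^ (m * n) = q := by
  -- Bezout over `ℤ`: `m·A + n·B = 1`
  have hbez : (m : ℤ) * Nat.gcdA m n + (n : ℤ) * Nat.gcdB m n = 1 := by
    rw [← Nat.gcd_eq_gcd_ab m n, Nat.Coprime.gcd_eq_one hmn, Nat.cast_one]
  refine ⟨a ^ Nat.gcdB m n * b ^ Nat.gcdA m n, ?_⟩
  rw [← zpow_natCast, mul_zpow, ← zpow_mul, ← zpow_mul]
  have e1 : a ^ (Nat.gcdB m n * ((m * n : ℕ) : ℤ)) = q ^ ((n : ℤ) * Nat.gcdB m n) := by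
    rw [show Nat.gcdB m n * ((m * n : ℕ) : ℤ) = (m : ℤ) * ((n : ℤ) * Nat.gcdB m n) by push_cast; ring,
      zpow_mul, zpow_natCast, ha]
  have e2 : b ^ (Nat.gcdA m n * ((m * n : ℕ) : ℤ)) = q ^ ((m : ℤ) * Nat.gcdA m n) := by
    rw [show Nat.gcdA m n * ((m * n : ℕ) : ℤ) = (n : ℤ) * ((m : ℤ) * Nat.gcdA m n) by push_cast; ring,
      zpow_mul, zpow_natCast, hb]
  rw [e1, e2, ← zpow_add₀ hq, show (n : ℤ) * Nat.gcdB m n + (m : ℤ) * Nat.gcdA m n = 1 by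
    rw [← hbez]; ring, zpow_one]

/-! ### `n`-torsion of `K^×/q^ℤ` -/

section Tate

variable {K : Type u} [NontriviallyNormedField K] [CompleteSpace K] [IsUltrametricDist K]
  [CharZero K] {q : K}

/-- `φ(uⁿ) = n • φ(u)` for Tate's map `φ : K^× → E_q(K)` (it is a homomorphism, ATAEC V.3.1 (c)).
[cite: SilvermanATAEC1994, Thm. V.3.1 (c) (PDF p. 395)] -/
theorem tatePoint_pow (hq0 : q ≠ 0) (hq : ‖q‖ < 1) (u : Kˣ) (n : ℕ) :
    tatePoint q (u ^ n) = n • tatePoint q u := by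
  have h := map_pow (tatePointMulHom hq0 hq) u n
  rw [tatePointMulHom_apply, tatePointMulHom_apply, ← ofAdd_nsmul] at h
  exact Multiplicative.ofAdd.injective h

/-- `φ(u · qᵏ) = φ(u)` for `k : ℤ` (`q^ℤ` is the kernel of `φ`).
[cite: SilvermanATAEC1994, Thm. V.3.1 (c) (PDF p. 395)] -/
theorem tatePoint_mul_zpow (hq0 : q ≠ 0) (hq : ‖q‖ < 1) (u : Kˣ) (k : ℤ) :
    tatePoint q (u * Units.mk0 q hq0 ^ k) = tatePoint q u := by
  have hker : Units.mk0 q hq0 ^ k ∈ (tatePointMulHom hq0 hq).ker := by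
    rw [ker_tatePointMulHom hq0 hq]
    exact ⟨k, rfl⟩
  have h := map_mul (tatePointMulHom hq0 hq) u (Units.mk0 q hq0 ^ k)
  rw [MonoidHom.mem_ker] at hker
  rw [hker, mul_one, tatePointMulHom_apply, tatePointMulHom_apply] at h
  exact Multiplicative.ofAdd.injective h

/-- **A normalised lift of an `n`-torsion point**: every `P ∈ E_q(K)` with `n • P = O` (`0 < n`) is `φ(w)`
for some `w ∈ K^×` with `wⁿ = qˢ`, `0 ≤ s < n` (lift by surjectivity, `φ(wⁿ) = n • P = O` gives
`wⁿ = qᵐ`, then divide `w` by `q^⌊m/n⌋`). [cite: SilvermanATAEC1994, Thm. V.3.1 (c)(d) (PDF p. 395)] -/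
theorem exists_lift_of_nsmul_eq_zero (hq0 : q ≠ 0) (hq : ‖q‖ < 1) {n : ℕ} (hn : 0 < n)
    {P : (tateCurve q).toAffine.Point} (hP : n • P = 0) :
    ∃ w : Kˣ, tatePoint q w = P ∧ ∃ s : ℕ, s < n ∧ (w : K) ^ n = q ^ s := by
  obtain ⟨u, hu⟩ := tatePoint_surjective addRelX_eq_zero addRelY_eq_zero hq0 hq P
  -- `φ(uⁿ) = O`, so `uⁿ = qᵐ`
  have hun : tatePoint q (u ^ n) = 0 := by rw [tatePoint_pow hq0 hq, hu, hP]
  obtain ⟨m, hm⟩ := (tatePoint_eq_zero_iff hq0 hq _).mp hun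
  rw [Units.val_pow_eq_pow_val] at hm
  -- `m = n k + s`, `0 ≤ s < n`
  set k : ℤ := m / n with hk
  set s : ℤ := m % n with hs
  have hs0 : 0 ≤ s := Int.emod_nonneg _ (by exact_mod_cast hn.ne')
  have hsn : s < n := Int.emod_lt_of_pos _ (by exact_mod_cast hn)
  have hms : (n : ℤ) * k + s = m := by rw [hk, hs, Int.emod_def]; ring
  refine ⟨u * Units.mk0 q hq0 ^ (-k), ?_, s.toNat, ?_, ?_⟩
  · rw [tatePoint_mul_zpow hq0 hq, hu]
  · have : (s.toNat : ℤ) < n := by rwa [Int.toNat_of_nonneg hs0]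
    exact_mod_cast this
  · rw [Units.val_mul, Units.val_zpow_eq_zpow_val, Units.val_mk0, mul_pow, ← zpow_natCast (q ^ (-k)),
      ← zpow_mul, hm, ← zpow_add₀ hq0, ← zpow_natCast q, Int.toNat_of_nonneg hs0]
    congr 1
    rw [← hms]
    ring

/-- **Rational `n`-torsion forces an `n`-th root of `q`.** Let `K` be a complete ultrametric field of
characteristic `0`, `0 < ‖q‖ < 1`, `0 < n`. If the Tate curve `E_q` has `n²` distinct `K`-points killed by `n`,
then `q = rⁿ` for some `r ∈ K`. Proof: by `exists_lift_of_nsmul_eq_zero` each such `P` is `φ(w_P)` with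
`w_Pⁿ = q^{s_P}`, `0 ≤ s_P < n`; `P ↦ w_P` is injective (`P = φ(w_P)`) into the union over `s < n` of the
`n`-th roots of `qˢ` in `K`, each of which has at most `n` elements — and the `s = 1` piece is empty unless
`q` is an `n`-th power; so otherwise `n² ≤ #S ≤ n(n − 1)`, absurd. (Silverman ATAEC V.3.1 (c)(d): the
`n`-torsion of `K^×/q^ℤ`.) [cite: SilvermanATAEC1994, Thm. V.3.1 (c)(d) (PDF p. 395)] -/
theorem exists_pow_eq_of_torsion (hq0 : q ≠ 0) (hq : ‖q‖ < 1) {n : ℕ} (hn : 0 < n)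
    (S : Finset (tateCurve q).toAffine.Point) (hS : ∀ P ∈ S, n • P = 0) (hcard : n ^ 2 ≤ S.card) :
    ∃ r : K, r ^ n = q := by
  by_contra hroot
  -- normalised lifts
  have key : ∀ P ∈ S, ∃ w : Kˣ, tatePoint q w = P ∧ ∃ s : ℕ, s < n ∧ (w : K) ^ n = q ^ s :=
    fun P hP => exists_lift_of_nsmul_eq_zero hq0 hq hn (hS P hP)
  choose! w hw hsw using key
  choose! s hs hws using hsw
  -- the target: `n`-th roots of `qˢ`, `s < n`
  let T : Finset K := (Finset.range n).biUnion fun t => (nthRoots n (q ^ t)).toFinset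
  have hmaps : ∀ P ∈ S, (w P : K) ∈ T := by
    intro P hP
    refine Finset.mem_biUnion.mpr ⟨s P, Finset.mem_range.mpr (hs P hP), ?_⟩
    rw [Multiset.mem_toFinset, mem_nthRoots hn]
    exact hws P hP
  have hinj : Set.InjOn (fun P => (w P : K)) S := by
    intro P hP P' hP' h
    have h' : w P = w P' := Units.ext h
    rw [← hw P hP, ← hw P' hP', h']
  have h1 : S.card ≤ T.card := Finset.card_le_card_of_injOn _ hmaps hinj
  -- `#T ≤ n (n - 1)`: each piece has `≤ n` elements and the piece `t = 1` is empty
  have hpiece : ∀ t, ((nthRoots n (q ^ t)).toFinset : Finset K).card ≤ n := fun t =>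
    (Multiset.toFinset_card_le _).trans (card_nthRoots n _)
  have hone : ((nthRoots n (q ^ 1)).toFinset : Finset K) = ∅ := by
    rw [Finset.eq_empty_iff_forall_notMem]
    intro r hr
    rw [Multiset.mem_toFinset, mem_nthRoots hn, pow_one] at hr
    exact hroot ⟨r, hr⟩
  have hn1 : 1 < n := by
    rcases Nat.lt_or_ge 1 n with h | h
    · exact h
    · exfalso
      have : n = 1 := le_antisymm h hn
      subst this
      exact hroot ⟨q, pow_one q⟩
  have h2 : T.card ≤ (n - 1) * n := by
    calc T.card ≤ ∑ t ∈ Finset.range n, ((nthRoots n (q ^ t)).toFinset : Finset K).card :=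
          Finset.card_biUnion_le
      _ = ∑ t ∈ (Finset.range n).erase 1, ((nthRoots n (q ^ t)).toFinset : Finset K).card := by
          rw [← Finset.sum_erase_add _ _ (Finset.mem_range.mpr hn1), hone, Finset.card_empty, add_zero]
      _ ≤ ∑ _t ∈ (Finset.range n).erase 1, n := Finset.sum_le_sum fun t _ => hpiece t
      _ = (n - 1) * n := by
          rw [Finset.sum_const, smul_eq_mul, Finset.card_erase_of_mem (Finset.mem_range.mpr hn1),
            Finset.card_range]
  have h3 : (n - 1) * n < n ^ 2 := by
    obtain ⟨k, rfl⟩ : ∃ k, n = k + 1 := ⟨n - 1, by omega⟩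
    rw [Nat.add_sub_cancel, sq]
    nlinarith
  omega

/-! ### Transport to a curve `K`-isomorphic to the Tate curve -/

/-- **The same through any injective homomorphism into `E_q(K)`**: if an additive group `A` embeds in `E_q(K)`
and has `n²` distinct elements killed by `n`, then `q` is an `n`-th power in `K`.
[cite: SilvermanATAEC1994, Thm. V.3.1 (c)(d) (PDF p. 395)] -/
theorem exists_pow_eq_of_torsion_of_injective (hq0 : q ≠ 0) (hq : ‖q‖ < 1) {A : Type*} [AddCommGroup A]
    (e : A →+ (tateCurve q).toAffine.Point) (he : Function.Injective e) {n : ℕ} (hn : 0 < n)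
    (S : Finset A) (hS : ∀ P ∈ S, n • P = 0) (hcard : n ^ 2 ≤ S.card) : ∃ r : K, r ^ n = q := by
  refine exists_pow_eq_of_torsion hq0 hq hn (S.map ⟨e, he⟩) ?_ ?_
  · intro P hP
    obtain ⟨Q, hQ, rfl⟩ := Finset.mem_map.mp hP
    show n • e Q = 0
    rw [← map_nsmul, hS Q hQ, map_zero]
  · rwa [Finset.card_map]

/-- **The same for any curve `K`-isomorphic to `E_q`**: if `C • E = tateCurve q` for a change of variables
`C` over `K` and `E(K)` has `n²` distinct points killed by `n`, then `q` is an `n`-th power in `K` (torsion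
is transported along the tree's `VariableChange.pointEquiv E C : E(K) ≃+ (C • E)(K)`).
[cite: SilvermanATAEC1994, Thm. V.5.3 (PDF pp. 407–409)] -/
theorem exists_pow_eq_of_torsion_of_variableChange (E : WeierstrassCurve K) {q : K} (hq0 : q ≠ 0)
    (hq : ‖q‖ < 1) (C : VariableChange K) (hC : C • E = tateCurve q) {n : ℕ} (hn : 0 < n)
    (S : Finset E.toAffine.Point) (hS : ∀ P ∈ S, n • P = 0) (hcard : n ^ 2 ≤ S.card) :
    ∃ r : K, r ^ n = q := by
  have e : E.toAffine.Point ≃+ (tateCurve q).toAffine.Point := by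
    rw [← hC]
    exact VariableChange.pointEquiv E C
  exact exists_pow_eq_of_torsion_of_injective hq0 hq e.toAddMonoidHom e.injective hn S hS hcard

end Tate

end Literature.NumberTheory.EllipticCurves.TateCurve

end
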